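/-
Copyright (c) 2026 The HCML crux team. All rights reserved.
Released under Apache 2.0 license as described in the file LICENSE.
Authors: K2E3-p23 (g4) (explicit-unit `hodgecm-mathlib-K2E3-p23-g4`)
-/
import Summits.HodgeConjecture.HodgeConjecture.Theorems.K2E3GL3FinConj            -- ★ (GL-3b) p857612 (this seat): `finConjGL` and its §1 kit; brings ★ GL-5/GL-U/GL-6/F3a/F1/tails
import HarnessLib

/-!
# (GL-[M6]-sc, B1⁰) `finConjGL` over an ADMISSIBLE domain — the compact-centraliser form of Harish-Chandra's finiteness on `Ḡ = GL₃(F) ⧸ Z`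

Cell `hodgecm-mathlib`, Track B, line `K2_E3_EllipticInputs`; payer «GL-[M6]-sc» of leaf (11-3-split-sc) (dealer K2E3-plan (g3) D63, line lead K2E3-p23 (g4); census
`CENSUS-M6sc-GL3SupercuspidalSplit.K2E3-p23-g4.md`).  ★ (GL-3b) `finConjGL` integrates the conjugation fibre `W(ḡ) = ∫_Ḡ β(x̄ ḡ x̄⁻¹)` over `C ∩ {W < ⊤}`; the transfers of
road «GL-[M6]-sc» along the central quotients `GL₃ ⧸ Λ → Ḡ` (compact kernel) need the SAME finiteness over `C ∩ {Z_Ḡ(ḡ) compact}` (a domain defined group-theoretically,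
hence comparable across the quotient map), and more generally over any `A ⊆ C` all of whose elements with `β ≢ 0` on their orbit have compact centraliser.  This file
re-runs ★ GL-3b's proof verbatim (two-parameter Cartan cover, normalised lifts, block shapes, ★ GL-6 contrapositive, ★ GL-5 torus averaging, pair-geometric tail) and ends
with ★ F3a‴ `lintegral_fibre_lt_top_of_boxDecay_of_admissible` (ED. 3) instead of F3a′:

* **`finConjGL_of_admissible`** — `∀ A ⊆ C` admissible: `∫⁻_{A} W dμ̄ < ⊤`;
* **`finConjGL_cc`** — `∫⁻_{C ∩ {Z(ḡ) compact}} W dμ̄ < ⊤`.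

HONEST LABEL: HC_CM is proved only modulo the 7 printed citations (2 remaining named inputs: hLiu418 = stmt-HodgeConjecture-24832, h413 =
stmt-HodgeConjecture-24833) until rung 0 closes; count-neutral (kernel lane `--supports stmt-HodgeConjecture-24833 --as helper`).

References: Harish-Chandra (van Dijk) 1970, Part VII §2 [cite: HarishChandra1970, Part VII §2 p. 69]; Cartier 1979 §IV [cite: Cartier1979, §IV.1];
Rogawski 1990 §1.10 [cite: Rogawski1990, §1.10 p. 9].
-/

open MeasureTheory MeasureTheory.Measure Set Function
open scoped NNReal ENNReal MatrixGroups Pointwise WithZero Valued Topology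
open ValuativeRel Matrix
open Literature.NumberTheory.Automorphic Literature.NumberTheory.GaloisRepresentations Literature.NumberTheory.GaloisRepresentations.IsNonarchimedeanLocalField
open Summit.HodgeConjecture.HodgeConjecture.Cruxes.H413.K2E3GL3ModCentre Summit.HodgeConjecture.HodgeConjecture.Cruxes.H413.K2E3GL3FinConjBoxes
open Summit.HodgeConjecture.HodgeConjecture.Cruxes.H413.K2E3GL3TorusAveraging Summit.HodgeConjecture.HodgeConjecture.Cruxes.H413.K2E3GL3BlockHenselCentralizer
open Summit.HodgeConjecture.HodgeConjecture.Cruxes.H413.K2E3FinConjCartanCover Summit.HodgeConjecture.HodgeConjecture.Cruxes.H413.K2E3FinConjOfBoxDecay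
open Summit.HodgeConjecture.HodgeConjecture.Cruxes.H413.K2E3GeometricTailSummable Summit.HodgeConjecture.HodgeConjecture.Cruxes.H413.K2E3SplitTorusTwistModuleBound
open Summit.HodgeConjecture.HodgeConjecture.Cruxes.H413.K2E3GL3FinConj

set_option linter.dupNamespace false

namespace Summit.HodgeConjecture.HodgeConjecture.Cruxes.H413.K2E3GL3FinConjAdmissible

/-! ## §1 `finConjGL_of_admissible` -/

section Main

/-- **(FC-GL) OVER AN ADMISSIBLE DOMAIN.**  Same data as ★ `finConjGL`; for every `A ⊆ C` such that each `g ∈ A` whose orbit meets `{β ≠ 0}` has compact centraliser: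
`∫⁻_{A} ∫⁻ β(x̄ ḡ x̄⁻¹) dμ̄ dμ̄ < ⊤` (★ GL-3b's proof verbatim, closed by ★ F3a‴). [cite: HarishChandra1970, Part VII §2 p. 69] [cite: Cartier1979, §IV.1] -/
theorem finConjGL_of_admissible {F : Type*} [Field F] [Valued F ℤᵐ⁰] [ValuativeRel F] [(Valued.v : Valuation F ℤᵐ⁰).Compatible] [IsNonarchimedeanLocalField F] [CharZero F]
    {ϖ : F} (hϖ : Valued.v ϖ = WithZero.exp (-1 : ℤ))
    [MeasurableSpace (GL (Fin 3) F ⧸ Subgroup.center (GL (Fin 3) F))] [BorelSpace (GL (Fin 3) F ⧸ Subgroup.center (GL (Fin 3) F))]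
    (μ : Measure (GL (Fin 3) F ⧸ Subgroup.center (GL (Fin 3) F))) [μ.IsHaarMeasure]
    {C : Set (GL (Fin 3) F ⧸ Subgroup.center (GL (Fin 3) F))} (hC : IsCompact C)
    {β : (GL (Fin 3) F ⧸ Subgroup.center (GL (Fin 3) F)) → ℝ≥0∞} (hβ : Continuous β) (hβs : IsCompact (tsupport β))
    {Mb : ℝ≥0∞} (hMb : Mb ≠ ⊤) (hβM : ∀ g, β g ≤ Mb)
    {A : Set (GL (Fin 3) F ⧸ Subgroup.center (GL (Fin 3) F))} (hAC : A ⊆ C)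
    (hAZ : ∀ x : GL (Fin 3) F ⧸ Subgroup.center (GL (Fin 3) F), ∀ g ∈ A, x * g * x⁻¹ ∈ {u : GL (Fin 3) F ⧸ Subgroup.center (GL (Fin 3) F) | β u ≠ 0} →
      g ∈ {h : GL (Fin 3) F ⧸ Subgroup.center (GL (Fin 3) F) | IsCompact ((Subgroup.centralizer ({h} : Set (GL (Fin 3) F ⧸ Subgroup.center (GL (Fin 3) F)))) :
        Set (GL (Fin 3) F ⧸ Subgroup.center (GL (Fin 3) F)))}) :
    ∫⁻ g in A, ∫⁻ x, β (x * g * x⁻¹) ∂μ ∂μ < ⊤ := by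
  -- §0 frame
  haveI : SecondCountableTopology (GL (Fin 3) F) := secondCountableTopology_gl3 F
  haveI : LocallyCompactSpace (GL (Fin 3) F) := locallyCompactSpace_gl3 F
  haveI : T2Space (GL (Fin 3) F ⧸ Subgroup.center (GL (Fin 3) F)) := t2Space_quot F
  haveI : μ.IsMulRightInvariant := K2E3GL3ModCentreUnimodular.isMulRightInvariant_quot_of_isHaarMeasure hϖ μ
  have hϖ0 : ϖ ≠ 0 := fun h => by rw [h, map_zero] at hϖ; exact WithZero.zero_ne_coe hϖ
  -- §1 `K̄`, the Cartan pairs, the cover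
  set Kb : Subgroup (GL (Fin 3) F ⧸ Subgroup.center (GL (Fin 3) F)) := (glInt 3 F).map (QuotientGroup.mk' (Subgroup.center (GL (Fin 3) F))) with hKb
  have hKo : IsOpen (Kb : Set (GL (Fin 3) F ⧸ Subgroup.center (GL (Fin 3) F))) := isOpen_kbar F
  have hKc : IsCompact (Kb : Set (GL (Fin 3) F ⧸ Subgroup.center (GL (Fin 3) F))) := isCompact_kbar F
  set tt : {p : ℕ × ℕ // p.2 ≤ p.1} → GL (Fin 3) F := fun p => zpowDiagGL (n := 3) hϖ0 ![-(p.1.1 : ℤ), -(p.1.2 : ℤ), 0] with htt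
  set t : {p : ℕ × ℕ // p.2 ≤ p.1} → GL (Fin 3) F ⧸ Subgroup.center (GL (Fin 3) F) :=
    fun p => QuotientGroup.mk' (Subgroup.center (GL (Fin 3) F)) (zpowDiagGL (n := 3) hϖ0 ![-(p.1.1 : ℤ), -(p.1.2 : ℤ), 0]) with ht
  have hcov : ∀ x : GL (Fin 3) F ⧸ Subgroup.center (GL (Fin 3) F), ∃ p,
      x ∈ (Kb : Set (GL (Fin 3) F ⧸ Subgroup.center (GL (Fin 3) F))) * {t p} * (Kb : Set (GL (Fin 3) F ⧸ Subgroup.center (GL (Fin 3) F))) := by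
    intro x
    obtain ⟨p, hp⟩ := exists_mem_doubleCoset_mk_tPair hϖ hϖ0 x
    exact ⟨p, hp⟩
  have htmk : ∀ p, t p = (QuotientGroup.mk (tt p) : GL (Fin 3) F ⧸ Subgroup.center (GL (Fin 3) F)) := fun p => rfl
  -- §2 the box `Ω̄ = K̄ (C ∪ tsupport β) K̄`
  set S₀ : Set (GL (Fin 3) F ⧸ Subgroup.center (GL (Fin 3) F)) := C ∪ tsupport β with hS₀
  have hS₀c : IsCompact S₀ := hC.union hβs
  set Ω : Set (GL (Fin 3) F ⧸ Subgroup.center (GL (Fin 3) F)) :=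
    (Kb : Set (GL (Fin 3) F ⧸ Subgroup.center (GL (Fin 3) F))) * S₀ * (Kb : Set (GL (Fin 3) F ⧸ Subgroup.center (GL (Fin 3) F))) with hΩ
  have hΩc : IsCompact Ω := isCompact_box _ hKc hS₀c
  have hΩm : MeasurableSet Ω := hΩc.isClosed.measurableSet
  have hCΩ : C ⊆ Ω := (Set.subset_union_left).trans (subset_box _ S₀)
  have hβΩ : ∀ g, β g ≠ 0 → g ∈ Ω := fun g hg => subset_box _ S₀ (Set.subset_union_right (subset_tsupport β hg))
  have hΩl : ∀ k ∈ Kb, ∀ g, k * g ∈ Ω ↔ g ∈ Ω := fun k hk g => mul_mem_box_iff _ S₀ hk g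
  have hΩr : ∀ k ∈ Kb, ∀ g, g * k ∈ Ω ↔ g ∈ Ω := fun k hk g => mem_box_mul_iff _ S₀ hk g
  obtain ⟨Fs, hΩF⟩ := exists_finset_subset_biUnion_smul Kb hKo hΩc
  obtain ⟨N, hN⟩ := exists_bound_of_isCompact_image hϖ hΩc
  -- §3 a Haar measure on `Fˣ` and the two (GL-5) decay packages
  letI : MeasurableSpace Fˣ := borel Fˣ
  haveI : BorelSpace Fˣ := ⟨rfl⟩
  haveI : SecondCountableTopology Fˣ := secondCountableTopology_units F
  obtain ⟨κ₁, hκ₁, C₁, hC₁, h5I⟩ := K2E3GL3TorusAveraging.measure_inter_collI_le (Measure.haar : Measure Fˣ) μ hϖ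
  obtain ⟨κ₂, hκ₂, C₂, hC₂, h5II⟩ := K2E3GL3TorusAveraging.measure_inter_collII_le (Measure.haar : Measure Fˣ) μ hϖ
  -- §4 constants: `κ = min`, `Cm = max`, `x = |ϖ|`, `ρ = x^κ`, `s = ρ^{1/4}`, `σ = max(s^{1/2}, 1/2)`, `A₀ = c = 96N + 4`, `D`, `ε`
  set κ : ℝ := min κ₁ κ₂ with hκ
  have hκ0 : 0 < κ := lt_min hκ₁ hκ₂
  set Cm : ℝ≥0∞ := max C₁ C₂ with hCm
  have hCmT : Cm ≠ ⊤ := (max_lt hC₁.lt_top hC₂.lt_top).ne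
  set x : ℝ≥0∞ := ((normAbs F ϖ : ℝ≥0) : ℝ≥0∞) with hx
  have hx1 : x < 1 := by
    have hv : Valued.v ϖ < Valued.v (1 : F) := by
      rw [hϖ, map_one, ← WithZero.exp_zero]; exact WithZero.exp_lt_exp.2 (by norm_num)
    have hle : normAbs F ϖ ≤ normAbs F 1 := (v_le_iff_normAbs_le _ _).1 hv.le
    have hne : normAbs F ϖ ≠ normAbs F 1 := fun h => hv.ne ((v_eq_iff_normAbs_eq _ _).2 h)
    rw [map_one] at hle hne
    rw [hx]; exact_mod_cast lt_of_le_of_ne hle hne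
  have hx0 : x ≠ 0 := by rw [hx]; exact_mod_cast (map_ne_zero (normAbs F)).2 hϖ0
  have hxT : x ≠ ⊤ := ENNReal.coe_ne_top
  set ρ : ℝ≥0∞ := x ^ κ with hρ
  have hρ1 : ρ < 1 := ENNReal.rpow_lt_one hx1 hκ0
  have hρ0 : ρ ≠ 0 := (ENNReal.rpow_pos (pos_iff_ne_zero.2 hx0) hxT).ne'
  have hρT : ρ ≠ ⊤ := (hρ1.trans ENNReal.one_lt_top).ne
  set s : ℝ≥0∞ := ρ ^ (1 / 4 : ℝ) with hs
  have hs1 : s < 1 := ENNReal.rpow_lt_one hρ1 (by norm_num)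
  have hs0 : s ≠ 0 := (ENNReal.rpow_pos (pos_iff_ne_zero.2 hρ0) hρT).ne'
  have hsT : s ≠ ⊤ := (hs1.trans ENNReal.one_lt_top).ne
  set σ₀ : ℝ≥0∞ := s ^ (1 / 2 : ℝ) with hσ₀
  have hσ₀1 : σ₀ < 1 := ENNReal.rpow_lt_one hs1 (by norm_num)
  have hsσ₀ : s = σ₀ ^ 2 := by rw [hσ₀, ← ENNReal.rpow_natCast, ← ENNReal.rpow_mul]; norm_num
  set σ : ℝ≥0∞ := max σ₀ 2⁻¹ with hσ
  have hσ1 : σ < 1 := max_lt hσ₀1 (by norm_num)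
  set c : ℕ := 96 * N + 4 with hc
  set D : ℝ≥0∞ := Cm * (s ^ c)⁻¹ + 2 ^ (2 * c) with hD
  have hscT : (s ^ c)⁻¹ ≠ ⊤ := by rw [ne_eq, ENNReal.inv_eq_top]; exact pow_ne_zero _ hs0
  have hDT : D ≠ ⊤ := ENNReal.add_ne_top.2 ⟨ENNReal.mul_ne_top hCmT hscT, ENNReal.pow_ne_top ENNReal.ofNat_ne_top⟩
  set ε : {p : ℕ × ℕ // p.2 ≤ p.1} → ℝ≥0∞ := fun p => D * (σ ^ p.1.1 * σ ^ p.1.2) with hε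
  have hεsum : ∑' p, ε p ≠ ⊤ := tsum_pair_geometric_ne_top hDT hσ1
  -- `ε ≥ 1` on the finitely many small pairs, and the geometric majorant of the (GL-5) constants on the large ones
  have hε1 : ∀ p : {p : ℕ × ℕ // p.2 ≤ p.1}, p.1.1 < c → 1 ≤ ε p := by
    intro p hp
    have hb : p.1.2 ≤ p.1.1 := p.2
    have h2 : (2 : ℝ≥0∞)⁻¹ ^ p.1.1 * (2 : ℝ≥0∞)⁻¹ ^ p.1.2 ≤ σ ^ p.1.1 * σ ^ p.1.2 :=
      mul_le_mul' (pow_le_pow_left' (le_max_right _ _) _) (pow_le_pow_left' (le_max_right _ _) _)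
    have h3 : (1 : ℝ≥0∞) ≤ 2 ^ (2 * c) * ((2 : ℝ≥0∞)⁻¹ ^ p.1.1 * (2 : ℝ≥0∞)⁻¹ ^ p.1.2) := by
      rw [← pow_add]
      have h4 : (2 : ℝ≥0∞)⁻¹ ^ (2 * c) ≤ (2 : ℝ≥0∞)⁻¹ ^ (p.1.1 + p.1.2) :=
        pow_le_pow_right_of_le_one' (ENNReal.inv_le_one.2 one_le_two) (by omega)
      calc (1 : ℝ≥0∞) = 2 ^ (2 * c) * (2 : ℝ≥0∞)⁻¹ ^ (2 * c) := by
            rw [← mul_pow, ENNReal.mul_inv_cancel two_ne_zero ENNReal.ofNat_ne_top, one_pow]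
        _ ≤ 2 ^ (2 * c) * (2 : ℝ≥0∞)⁻¹ ^ (p.1.1 + p.1.2) := mul_le_mul' le_rfl h4
    calc (1 : ℝ≥0∞) ≤ 2 ^ (2 * c) * ((2 : ℝ≥0∞)⁻¹ ^ p.1.1 * (2 : ℝ≥0∞)⁻¹ ^ p.1.2) := h3
      _ ≤ D * (σ ^ p.1.1 * σ ^ p.1.2) := mul_le_mul' (by rw [hD]; exact le_add_self) h2
  have hεmaj : ∀ p : {p : ℕ × ℕ // p.2 ≤ p.1}, ∀ j : ℕ, p.1.1 ≤ 4 * j + c → ∀ (Cs : ℝ≥0∞) (κs : ℝ), Cs ≤ Cm → κ ≤ κs →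
      Cs * ((normAbs F (ϖ ^ j) : ℝ≥0) : ℝ≥0∞) ^ κs ≤ ε p := by
    intro p j hj Cs κs hCs hκs
    have hb : p.1.2 ≤ p.1.1 := p.2
    -- `|ϖ^j|^{κs} ≤ ρ^j`
    have h1 : ((normAbs F (ϖ ^ j) : ℝ≥0) : ℝ≥0∞) ^ κs ≤ ρ ^ j := by
      rw [map_pow, ENNReal.coe_pow, rpow_pow_comm, hρ]
      exact pow_le_pow_left' (ENNReal.rpow_le_rpow_of_exponent_ge hx1.le hκs) j
    -- `ρ^j ≤ s^a (s^c)⁻¹ ≤ σ^a σ^b (s^c)⁻¹`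
    have h2 : ρ ^ j ≤ s ^ p.1.1 * (s ^ c)⁻¹ := pow_le_rpow_quarter_pow hρ0 hρ1.le hρT hj
    have h3 : s ^ p.1.1 ≤ σ ^ p.1.1 * σ ^ p.1.2 := by
      rw [hsσ₀, ← pow_mul, ← pow_add]
      calc σ₀ ^ (2 * p.1.1) ≤ σ₀ ^ (p.1.1 + p.1.2) := pow_le_pow_right_of_le_one' hσ₀1.le (by omega)
        _ ≤ σ ^ (p.1.1 + p.1.2) := pow_le_pow_left' (le_max_left _ _) _
    calc Cs * ((normAbs F (ϖ ^ j) : ℝ≥0) : ℝ≥0∞) ^ κs ≤ Cm * (s ^ p.1.1 * (s ^ c)⁻¹) := mul_le_mul' hCs (h1.trans h2)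
      _ ≤ Cm * (σ ^ p.1.1 * σ ^ p.1.2 * (s ^ c)⁻¹) := mul_le_mul' le_rfl (mul_le_mul' h3 le_rfl)
      _ = Cm * (s ^ c)⁻¹ * (σ ^ p.1.1 * σ ^ p.1.2) := by ring
      _ ≤ D * (σ ^ p.1.1 * σ ^ p.1.2) := mul_le_mul' (by rw [hD]; exact le_self_add) le_rfl
  -- §5 the decay on each box
  have hdecay : ∀ p, μ (Ω ∩ {h : GL (Fin 3) F ⧸ Subgroup.center (GL (Fin 3) F) | t p * h * (t p)⁻¹ ∈ Ω} ∩
      {h : GL (Fin 3) F ⧸ Subgroup.center (GL (Fin 3) F) | IsCompact ((Subgroup.centralizer ({h} : Set (GL (Fin 3) F ⧸ Subgroup.center (GL (Fin 3) F)))) :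
        Set (GL (Fin 3) F ⧸ Subgroup.center (GL (Fin 3) F)))}) ≤
      μ (Ω ∩ {h : GL (Fin 3) F ⧸ Subgroup.center (GL (Fin 3) F) | t p * h * (t p)⁻¹ ∈ Ω}) * ε p := by
    intro p
    set a : ℕ := p.1.1 with ha
    set b : ℕ := p.1.2 with hb
    have hba : b ≤ a := p.2
    set box : Set (GL (Fin 3) F ⧸ Subgroup.center (GL (Fin 3) F)) := Ω ∩ {h | t p * h * (t p)⁻¹ ∈ Ω} with hbox
    by_cases hsmall : a < c
    · exact (measure_mono Set.inter_subset_left).trans (le_mul_of_one_le_right zero_le (hε1 p hsmall))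
    rw [not_lt] at hsmall
    -- measurability and torus invariance of the box
    have hboxm : MeasurableSet box :=
      hΩm.inter (hΩm.preimage ((continuous_const.mul continuous_id).mul continuous_const).measurable)
    have htorus : ∀ d : Fin 3 → Fˣ, (∀ i, Valued.v ((d i : Fˣ) : F) = 1) →
        (QuotientGroup.mk (diagonalGL (Fin 3) F d) : GL (Fin 3) F ⧸ Subgroup.center (GL (Fin 3) F)) • box = box := by
      intro d hd
      have hsK : (QuotientGroup.mk (diagonalGL (Fin 3) F d) : GL (Fin 3) F ⧸ Subgroup.center (GL (Fin 3) F)) ∈ Kb :=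
        Subgroup.mem_map.2 ⟨diagonalGL (Fin 3) F d, diagonalGL_mem_glInt_of_v_eq_one d hd, rfl⟩
      have hst : (QuotientGroup.mk (diagonalGL (Fin 3) F d) : GL (Fin 3) F ⧸ Subgroup.center (GL (Fin 3) F)) * t p =
          t p * QuotientGroup.mk (diagonalGL (Fin 3) F d) := by
        rw [htmk, ← QuotientGroup.mk_mul, ← QuotientGroup.mk_mul, htt]
        exact congrArg _ (diagonalGL_mul_zpowDiagGL_comm hϖ0 d _)
      exact smul_boxPair_eq Kb S₀ hsK hst
    have hu1 : ∀ u : Fˣ, valuation F (u : F) = 1 → Valued.v (u : F) = 1 := fun u hu => (v_eq_one_iff_valuation_eq_one _).2 hu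
    have htorusI : ∀ u : Fˣ, valuation F (u : F) = 1 →
        (QuotientGroup.mk (diagonalGL (Fin 3) F ![u, 1, 1]) : GL (Fin 3) F ⧸ Subgroup.center (GL (Fin 3) F)) • box = box := fun u hu =>
      htorus _ fun i => by
        have hi : i = 0 ∨ i = 1 ∨ i = 2 := by decide +revert
        rcases hi with rfl | rfl | rfl
        · exact hu1 u hu
        · simp
        · simp
    have htorusII : ∀ u : Fˣ, valuation F (u : F) = 1 →
        (QuotientGroup.mk (diagonalGL (Fin 3) F ![1, 1, u]) : GL (Fin 3) F ⧸ Subgroup.center (GL (Fin 3) F)) • box = box := fun u hu =>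
      htorus _ fun i => by
        have hi : i = 0 ∨ i = 1 ∨ i = 2 := by decide +revert
        rcases hi with rfl | rfl | rfl
        · simp
        · simp
        · exact hu1 u hu
    -- the normalised lift of a box element and its entries
    have hlift : ∀ z ∈ box, ∃ h : GL (Fin 3) F, (QuotientGroup.mk h : GL (Fin 3) F ⧸ Subgroup.center (GL (Fin 3) F)) = z ∧
        (∀ i j, Valued.v ((h : Matrix (Fin 3) (Fin 3) F) i j) ≤ WithZero.exp (((2 * N : ℕ) : ℤ))) ∧
        WithZero.exp (-((6 * N : ℕ) : ℤ)) ≤ Valued.v (h : Matrix (Fin 3) (Fin 3) F).det ∧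
        Valued.v ((h : Matrix (Fin 3) (Fin 3) F) 0 1) ≤ WithZero.exp (((2 * N : ℕ) : ℤ) - ((a : ℤ) - b)) ∧
        Valued.v ((h : Matrix (Fin 3) (Fin 3) F) 0 2) ≤ WithZero.exp (((2 * N : ℕ) : ℤ) - a) ∧
        Valued.v ((h : Matrix (Fin 3) (Fin 3) F) 1 2) ≤ WithZero.exp (((2 * N : ℕ) : ℤ) - b) := by
      rintro z ⟨hz1, hz2⟩
      obtain ⟨h, rfl, hle1, hone⟩ := exists_normalized_lift hϖ hϖ0 z
      have hb0 := hN h hz1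
      have hdet : WithZero.exp (-(6 * (N : ℤ))) ≤ Valued.v (h : Matrix (Fin 3) (Fin 3) F).det := v_det_ge_of_scaleBound h hb0 hone
      have hconj : (QuotientGroup.mk (tt p * h * (tt p)⁻¹) : GL (Fin 3) F ⧸ Subgroup.center (GL (Fin 3) F)) ∈ Ω := by
        rw [QuotientGroup.mk_mul, QuotientGroup.mk_mul, QuotientGroup.mk_inv, ← htmk]; exact hz2
      have hb1 := hN _ hconj
      have hyM : ∀ i j, Valued.v (((tt p * h * (tt p)⁻¹ : GL (Fin 3) F) : Matrix (Fin 3) (Fin 3) F) i j) ≤ WithZero.exp (2 * (N : ℤ)) :=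
        fun i j => entries_le_of_scaleBound_of_one_le_v_det_inv _ hb1 (one_le_v_det_conj_inv (tt p) h hle1) i j
      have hyM' : ∀ i j, Valued.v (((zpowDiagGL hϖ0 ![-(a : ℤ), -(b : ℤ), 0] * h * (zpowDiagGL hϖ0 ![-(a : ℤ), -(b : ℤ), 0])⁻¹ : GL (Fin 3) F) :
          Matrix (Fin 3) (Fin 3) F) i j) ≤ WithZero.exp (((2 * N : ℕ) : ℤ)) := by
        intro i j; rw [Nat.cast_mul, Nat.cast_ofNat]; exact hyM i j
      obtain ⟨h01, h02, h12⟩ := v_upper_le_of_conj_tPair hϖ hϖ0 a b (2 * N) h hyM'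
      refine ⟨h, rfl, fun i j => (hle1 i j).trans ?_, by push_cast; exact hdet, h01, h02, h12⟩
      rw [← WithZero.exp_zero]; exact WithZero.exp_le_exp.2 (by positivity)
    -- a compact centraliser of `mk h` bounds the scale-invariant size of every `y` commuting with `h`
    have hcent : ∀ h : GL (Fin 3) F, IsCompact ((Subgroup.centralizer ({(QuotientGroup.mk h : GL (Fin 3) F ⧸ Subgroup.center (GL (Fin 3) F))} :
        Set (GL (Fin 3) F ⧸ Subgroup.center (GL (Fin 3) F)))) : Set (GL (Fin 3) F ⧸ Subgroup.center (GL (Fin 3) F))) →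
        ¬ ∀ N' : ℕ, ∃ y : GL (Fin 3) F, y * h = h * y ∧ ∃ i j i' j' : Fin 3,
          WithZero.exp (N' : ℤ) < Valued.v ((y : Matrix (Fin 3) (Fin 3) F) i j) * Valued.v (((y⁻¹ : GL (Fin 3) F) : Matrix (Fin 3) (Fin 3) F) i' j') := by
      intro h hZ hall'
      obtain ⟨N₁, hN₁⟩ := exists_bound_of_isCompact_image hϖ hZ
      obtain ⟨y, hyh, i, j, i', j', hlt⟩ := hall' (2 * N₁)
      have hy : (QuotientGroup.mk y : GL (Fin 3) F ⧸ Subgroup.center (GL (Fin 3) F)) ∈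
          ((Subgroup.centralizer ({(QuotientGroup.mk h : GL (Fin 3) F ⧸ Subgroup.center (GL (Fin 3) F))} : Set (GL (Fin 3) F ⧸ Subgroup.center (GL (Fin 3) F)))) : Set (GL (Fin 3) F ⧸ Subgroup.center (GL (Fin 3) F))) := by
        rw [SetLike.mem_coe, Subgroup.mem_centralizer_singleton_iff, ← QuotientGroup.mk_mul, ← QuotientGroup.mk_mul, hyh]
      have hle := hN₁ y hy i j i' j'
      rw [Nat.cast_mul, Nat.cast_ofNat] at hlt
      exact absurd (hlt.trans_le hle) (lt_irrefl _)
    -- the two shapes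
    by_cases hI : 2 * b ≤ a
    · -- SHAPE I: `d = a − b`
      set d : ℕ := a - b with hd
      set k : ℕ := (d - 8 * N - 1) / 2 with hk
      set j : ℕ := k - 20 * N with hj
      have hd1 : 4 * (2 * N) + 2 * k + 1 ≤ d := by omega
      have hd2 : 3 * (2 * N) + 6 * N < d := by omega
      have hkj : (k : ℤ) = j + 20 * N := by push_cast [hj]; omega
      have hja : a ≤ 4 * j + c := by omega
      have hsub : box ∩ {z | IsCompact ((Subgroup.centralizer ({z} : Set (GL (Fin 3) F ⧸ Subgroup.center (GL (Fin 3) F)))) : Set (GL (Fin 3) F ⧸ Subgroup.center (GL (Fin 3) F)))} ⊆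
          box ∩ (QuotientGroup.mk : GL (Fin 3) F → GL (Fin 3) F ⧸ Subgroup.center (GL (Fin 3) F)) ''
            {h : GL (Fin 3) F | Valued.v (((h : Matrix (Fin 3) (Fin 3) F) 0 0 - (h : Matrix (Fin 3) (Fin 3) F) 1 1) *
              ((h : Matrix (Fin 3) (Fin 3) F) 0 0 - (h : Matrix (Fin 3) (Fin 3) F) 2 2) - (h : Matrix (Fin 3) (Fin 3) F) 1 2 * (h : Matrix (Fin 3) (Fin 3) F) 2 1) <
              WithZero.exp (-(j : ℤ)) * Valued.v ((h : Matrix (Fin 3) (Fin 3) F) 0 0) ^ 2} := by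
        rintro z ⟨hz, hZ⟩
        refine ⟨hz, ?_⟩
        obtain ⟨h, rfl, hall, hdet, h01, h02, h12⟩ := hlift z hz
        have h01' : Valued.v ((h : Matrix (Fin 3) (Fin 3) F) 0 1) ≤ WithZero.exp (((2 * N : ℕ) : ℤ) - d) := by
          rw [hd, Nat.cast_sub hba]; exact h01
        have h02' : Valued.v ((h : Matrix (Fin 3) (Fin 3) F) 0 2) ≤ WithZero.exp (((2 * N : ℕ) : ℤ) - d) :=
          h02.trans (WithZero.exp_le_exp.2 (by rw [hd, Nat.cast_sub hba]; omega))
        have hQ : Valued.v ((((h : Matrix (Fin 3) (Fin 3) F) 0 0 - (h : Matrix (Fin 3) (Fin 3) F) 1 1) *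
            ((h : Matrix (Fin 3) (Fin 3) F) 0 0 - (h : Matrix (Fin 3) (Fin 3) F) 2 2) - (h : Matrix (Fin 3) (Fin 3) F) 1 2 * (h : Matrix (Fin 3) (Fin 3) F) 2 1)) <
            WithZero.exp (-(k : ℤ)) := by
          by_contra hcon
          exact hcent h hZ (exists_centralizer_unbounded_of_block_separated hϖ hd1 h hall h01' h02' (not_lt.1 hcon))
        have h00 := v_diag_ge_shapeI hd2 h hall h01' h02' hdet
        refine ⟨h, ?_, rfl⟩
        rw [mem_setOf_eq]
        refine hQ.trans_le ?_
        rw [hkj, neg_add, WithZero.exp_add]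
        refine mul_le_mul' le_rfl ?_
        have hsq := pow_le_pow_left' h00 2
        refine le_trans (le_of_eq ?_) hsq
        rw [pow_two, ← WithZero.exp_add]; congr 1; push_cast; ring
      exact (measure_mono hsub).trans ((h5I j box hboxm htorusI).trans
        ((mul_le_mul' (hεmaj p j hja C₁ κ₁ (le_max_left _ _) (min_le_left _ _)) le_rfl).trans_eq (mul_comm _ _)))
    · -- SHAPE II: `d = b`
      rw [not_le] at hI
      set d : ℕ := b with hd
      set k : ℕ := (d - 8 * N - 1) / 2 with hk
      set j : ℕ := k - 20 * N with hj
      have hd1 : 4 * (2 * N) + 2 * k + 1 ≤ d := by omega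
      have hd2 : 3 * (2 * N) + 6 * N < d := by omega
      have hkj : (k : ℤ) = j + 20 * N := by push_cast [hj]; omega
      have hja : a ≤ 4 * j + c := by omega
      have hsub : box ∩ {z | IsCompact ((Subgroup.centralizer ({z} : Set (GL (Fin 3) F ⧸ Subgroup.center (GL (Fin 3) F)))) : Set (GL (Fin 3) F ⧸ Subgroup.center (GL (Fin 3) F)))} ⊆
          box ∩ (QuotientGroup.mk : GL (Fin 3) F → GL (Fin 3) F ⧸ Subgroup.center (GL (Fin 3) F)) ''
            {h : GL (Fin 3) F | Valued.v (((h : Matrix (Fin 3) (Fin 3) F) 2 2 - (h : Matrix (Fin 3) (Fin 3) F) 0 0) *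
              ((h : Matrix (Fin 3) (Fin 3) F) 2 2 - (h : Matrix (Fin 3) (Fin 3) F) 1 1) - (h : Matrix (Fin 3) (Fin 3) F) 0 1 * (h : Matrix (Fin 3) (Fin 3) F) 1 0) <
              WithZero.exp (-(j : ℤ)) * Valued.v ((h : Matrix (Fin 3) (Fin 3) F) 2 2) ^ 2} := by
        rintro z ⟨hz, hZ⟩
        refine ⟨hz, ?_⟩
        obtain ⟨h, rfl, hall, hdet, h01, h02, h12⟩ := hlift z hz
        have h02' : Valued.v ((h : Matrix (Fin 3) (Fin 3) F) 0 2) ≤ WithZero.exp (((2 * N : ℕ) : ℤ) - d) :=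
          h02.trans (WithZero.exp_le_exp.2 (by rw [hd]; omega))
        have h12' : Valued.v ((h : Matrix (Fin 3) (Fin 3) F) 1 2) ≤ WithZero.exp (((2 * N : ℕ) : ℤ) - d) := by rw [hd]; exact h12
        have hQ : Valued.v ((((h : Matrix (Fin 3) (Fin 3) F) 2 2 - (h : Matrix (Fin 3) (Fin 3) F) 0 0) *
            ((h : Matrix (Fin 3) (Fin 3) F) 2 2 - (h : Matrix (Fin 3) (Fin 3) F) 1 1) - (h : Matrix (Fin 3) (Fin 3) F) 0 1 * (h : Matrix (Fin 3) (Fin 3) F) 1 0)) <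
            WithZero.exp (-(k : ℤ)) := by
          by_contra hcon
          exact hcent h hZ (exists_centralizer_unbounded_of_block_separated' hϖ hd1 h hall h02' h12' (not_lt.1 hcon))
        have h22 := v_diag_ge_shapeII hd2 h hall h02' h12' hdet
        refine ⟨h, ?_, rfl⟩
        rw [mem_setOf_eq]
        refine hQ.trans_le ?_
        rw [hkj, neg_add, WithZero.exp_add]
        refine mul_le_mul' le_rfl ?_
        have hsq := pow_le_pow_left' h22 2
        refine le_trans (le_of_eq ?_) hsq
        rw [pow_two, ← WithZero.exp_add]; congr 1; push_cast; ring
      exact (measure_mono hsub).trans ((h5II j box hboxm htorusII).trans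
        ((mul_le_mul' (hεmaj p j hja C₂ κ₂ (le_max_right _ _) (min_le_right _ _)) le_rfl).trans_eq (mul_comm _ _)))
  -- §6 the generic assembly ★ F3a′
  exact lintegral_fibre_lt_top_of_boxDecay_of_admissible μ Kb hKo hKc t hcov Ω hΩl hΩr Fs hΩF hCΩ hβ hβΩ hMb hβM ε hεsum hdecay hAC hAZ

/-- **(FC-GL), COMPACT-CENTRALISER DOMAIN**: `∫⁻_{C ∩ {Z_Ḡ(ḡ) compact}} ∫⁻ β(x̄ ḡ x̄⁻¹) dμ̄ dμ̄ < ⊤` — the form used by the central-quotient transfers of road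
«GL-[M6]-sc». [cite: HarishChandra1970, Part VII §2 p. 69] -/
theorem finConjGL_cc {F : Type*} [Field F] [Valued F ℤᵐ⁰] [ValuativeRel F] [(Valued.v : Valuation F ℤᵐ⁰).Compatible] [IsNonarchimedeanLocalField F] [CharZero F]
    {ϖ : F} (hϖ : Valued.v ϖ = WithZero.exp (-1 : ℤ))
    [MeasurableSpace (GL (Fin 3) F ⧸ Subgroup.center (GL (Fin 3) F))] [BorelSpace (GL (Fin 3) F ⧸ Subgroup.center (GL (Fin 3) F))]
    (μ : Measure (GL (Fin 3) F ⧸ Subgroup.center (GL (Fin 3) F))) [μ.IsHaarMeasure]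
    {C : Set (GL (Fin 3) F ⧸ Subgroup.center (GL (Fin 3) F))} (hC : IsCompact C)
    {β : (GL (Fin 3) F ⧸ Subgroup.center (GL (Fin 3) F)) → ℝ≥0∞} (hβ : Continuous β) (hβs : IsCompact (tsupport β))
    {Mb : ℝ≥0∞} (hMb : Mb ≠ ⊤) (hβM : ∀ g, β g ≤ Mb) :
    ∫⁻ g in C ∩ {h : GL (Fin 3) F ⧸ Subgroup.center (GL (Fin 3) F) | IsCompact ((Subgroup.centralizer ({h} : Set (GL (Fin 3) F ⧸ Subgroup.center (GL (Fin 3) F)))) :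
        Set (GL (Fin 3) F ⧸ Subgroup.center (GL (Fin 3) F)))}, ∫⁻ x, β (x * g * x⁻¹) ∂μ ∂μ < ⊤ :=
  finConjGL_of_admissible hϖ μ hC hβ hβs hMb hβM Set.inter_subset_left (fun _ _ hg _ => hg.2)

end Main

end Summit.HodgeConjecture.HodgeConjecture.Cruxes.H413.K2E3GL3FinConjAdmissible
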